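import Summits.AtomisticToContinuum.Crystallization.Theorems.OverbindingBudgetAffineRunCutHub
import Summits.AtomisticToContinuum.Crystallization.Theorems.OverbindingBudgetAffineRunCutRebase

/-!
# `OverbindingBudget` / crux `RobustDefectLimitWindows` (stmt-AtomisticToContinuum-31280) — «RunCut» part 24 «UNIAX»:
# THE UNIAXIAL CORE OF THE PIVOT DATUM, THE METROLOGY OF THE PIVOT BALL, AND THE EVENT-LOCAL ENGINE

Support file (lens-4 g91; order of record (2c), `ρ₁ = 30` FINAL-in-practice; memo `g91/memo/UNIAX-g91.md`; architecture `g89/memo/ATLAS-STAR-g89.md` §3,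
`g88/memo/UNIAX-g88.md` §1, `g88/memo/PHIFF-g88.md` §3).  Three hand-offs from the hub of part 23 to the laminate / far-field line (parts 25+):
* §1 ★★ `uniaxial_core_of_affDeepReg` (`ρ₁ ≥ 30`): the pivot datum `AffDeepReg ρ₁ (10⁻⁴) (10⁻³) (1/450) y j` of TREE `…AffineLadder` unpacks (TREE
  `…RunCutRebase.charts_of_affDeepReg_radius`) into chart FUNCTIONS `(Pc, Qc, Ac, fc)` carrying exactly the five section-`Atlas` clauses `hP hA hf hinj hex` of
  parts 22A–23C, and for EVERY mover `i` (`dist(y i, y j) ≤ 5/2 ν_j`) ONE unit vector `n` has every chart-hcp site within `10 ν_i` of `y i` reading its frame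
  axis within `1/100` of `±n` (23C-β `hub_uniaxial`); `uniaxial_core_thirty` = the literal instance `ρ₁ = 30`.
* §2 ★★ METROLOGY OF THE PIVOT BALL (section `Atlas`).  The legs of part 23 certify scales only within `10 ν_i` of a mover: a greedy walk FROM the site of
  known scale has a known start `R₀` but needs the ball `B(target, d)` charted (radius doubling: `B(m, 21 ν_j)` reaches `42 ν_j > ρ₁`), a walk TO it has
  trivial containment but an unknown start `R₀ = d/ν_m`.  HOPS fix both: `point_walk` — the space walk of `…RunCutLegCover.space_step` toward a POINT `x` from
  `dist(y p, x) ≤ 3.17 ν_p` ARRIVES (`dist(y c_n, x) < ν_{c_n}`) within `5` bonds (`…RunCutLegCover.leg_envelope` from rung `3.17`: `3` bonds to `R ≤ 3/2`, then 23C-α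
  `law_below`, `law_arrive`), its sites staying in `B(x, dist(y p, x))`; `pivot_hops` — `K ≤ 12` hops of length `‖w‖ ≤ 2 ν_j` along `y j + k•w` (`2K + 6 ≤ ρ₁`;
  hop `k+1` starts below `(1 + 2/0.936) ν_p ≤ 3.17 ν_p` and its containment ball lies within `(2k + 5.07) ν_j` of `y j`), window exponent `≤ 5k`;
  ★★ `pivot_window` — EVERY site `m` with `dist(y m, y j) ≤ 2K ν_j` is charted with `(10⁴/10011)^e ν_j ≤ ν_m ≤ (10011/10⁴)^e ν_j`, `e ≤ 5K` (the last hop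
  targets `x = y m`, and arrival `dist < ν_{c_n}` forces `c_n = m` by `nearestDist_le_dist`); `pivot_window_thirty`: `ρ₁ ≥ 30`, `dist(y m, y j) ≤ 24 ν_j` ⇒
  `0.936 ν_j ≤ ν_m ≤ 1.069 ν_j` (`(10011/10⁴)^60 = 1.06819`); `mover_window` (two hops): a mover has `0.989 ν_j ≤ ν_i ≤ 1.0111 ν_j`; `tight_ball`: every point
  within `R ν_i` of a mover lies within `(5/2 + 1.0111 R) ν_j` of the pivot (`R = 20`: `22.722 ν_j`).
* §3 ★★ `no_crossing_local` — THE EVENT-LOCAL ENGINE.  Part 22D-β `cross_engine` uses its reach constants `K, D` only through `‖z − y j‖ ≤ K·D ν_j` and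
  `K·D + 6.71 hi ≤ ρ₁`, and `walker_end` is already local to the event: so two h-sites `ma, mb` of the ball, windowed `lo ν_j ≤ ν ≤ hi ν_j` (`hi ≤ 1.35 lo`), whose
  axes read `|cos| ≤ c ≤ 87/250`, admit NO common point `z` of their two chart planes with `‖z − y ma‖ ≤ 38.28 ν_ma`, `‖z − y mb‖ ≤ 38.28 ν_mb` and
  `y ma, y mb, z ∈ B(y j, Z ν_j)`, `Z + 6.71 hi ≤ ρ₁` (instance `K := 1`, `D := Z`).  At `ρ₁ = 30`, `hi = 1.069`: events out to `Z = 22.8 ν_j` — versus the SITE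
  reach `D = 13` of 22D-β `no_crossing` — which is what the clean laminate of a tight ball `R_t ≈ 18–20 ν_i` needs (memo §3: `R_J ≤ 22.9` by reach,
  walk lengths `≤ 38.28 ν` by the consumer's choice of source sites; coarse far-field tail `5.33·3/R_t⁵` per column).
[this file: 0 definitions; imports `…RunCutHub` (23C-β) and `…RunCutRebase` (both tree); standard axioms]
-/

namespace Summit.AtomisticToContinuum.Crystallization.Theorems.OverbindingBudgetAffineRunCutUniax

open scoped InnerProductSpace
open Literature.Geometry.DiscreteGeometry
open Summit.AtomisticToContinuum.Crystallization.Theorems.OverbindingBudgetAffineLadder (AffDeepReg)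
open Summit.AtomisticToContinuum.Crystallization.Theorems.OverbindingBudgetAffineRunCutRebase (charts_of_affDeepReg_radius)
open Summit.AtomisticToContinuum.Crystallization.Theorems.OverbindingBudgetAffineCompressedCutEstablish (nearestDist_pos_of_frame)
open Summit.AtomisticToContinuum.Crystallization.Theorems.OverbindingBudgetAffineRunCutLegCover (space_step leg_law_normalise leg_envelope)
open Summit.AtomisticToContinuum.Crystallization.Theorems.OverbindingBudgetAffineRunCutLeg (bond_windows leg_scale)
open Summit.AtomisticToContinuum.Crystallization.Theorems.OverbindingBudgetAffineRunCutWalk (law_below law_arrive window_compose)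
open Summit.AtomisticToContinuum.Crystallization.Theorems.OverbindingBudgetAffineRunCutSheetCrossing (unit_axis walker_end cross_engine)
open Summit.AtomisticToContinuum.Crystallization.Theorems.OverbindingBudgetAffineRunCutHub (hub_uniaxial)

variable {N : ℕ}
local notation "E3" => EuclideanSpace ℝ (Fin 3)

/-! ## §1 The uniaxial core of the pivot datum -/

/-- ★★ UNIAXIAL CORE OF THE PIVOT DATUM (ATLAS-STAR-g89 §3 / UNIAX-g88 §1, ∃-normal form, per mover): for an injective configuration and a pivot `j` with
`AffDeepReg ρ₁ (10⁻⁴) (10⁻³) (1/450)`, `ρ₁ ≥ 30`, there are chart functions with the `Atlas` clauses such that for EVERY mover `i` (`dist(y i, y j) ≤ 5/2 ν_j`)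
ONE unit vector `n` has every chart-hcp site `m` within `10 ν_i` of `y i` reading its frame axis within `1/100` of `±n` — the chart FUNCTIONS are the tree's
`…RunCutRebase.charts_of_affDeepReg_radius` (one `choose` over the datum), the dichotomy is 23C-β `hub_uniaxial` (`17·33/10⁵ ≤ 1/100`). [this file] -/
theorem uniaxial_core_of_affDeepReg {y : Fin N → E3} (hy : Function.Injective y) {j : Fin N} {ρ₁ : ℝ} (hρ : 30 ≤ ρ₁)
    (hj : AffDeepReg ρ₁ (1 / 10 ^ 4) (1 / 1000) (1 / 450) y j) :
    ∃ (Pc : Fin N → Finset E3) (Qc : Fin N → E3 →ₗᵢ[ℝ] E3) (Ac : Fin N → E3 →ₗ[ℝ] E3) (fc : Fin N → E3 → E3),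
      (∀ i, dist (y i) (y j) ≤ ρ₁ * nearestDist y j → Pc i = fccTwoShellPattern ∨ Pc i = hcpTwoShellPattern) ∧
      (∀ i, dist (y i) (y j) ≤ ρ₁ * nearestDist y j → ∀ v ∈ Pc i, ‖Ac i v - Qc i v‖ ≤ 1 / 1000) ∧
      (∀ i, dist (y i) (y j) ≤ ρ₁ * nearestDist y j → ∀ v ∈ Pc i,
        fc i v ∈ Set.range y ∧ dist (fc i v) (y i + nearestDist y i • Ac i v) ≤ 1 / 10 ^ 4 * nearestDist y i) ∧
      (∀ i, dist (y i) (y j) ≤ ρ₁ * nearestDist y j → Set.InjOn (fc i) ↑(Pc i)) ∧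
      (∀ i, dist (y i) (y j) ≤ ρ₁ * nearestDist y j → ∀ k : Fin N, k ≠ i →
        dist (y k) (y i) ≤ (3 / 2 + 1 / 450) * nearestDist y i → ∃ v ∈ Pc i, fc i v = y k) ∧
      ∀ i, dist (y i) (y j) ≤ 5 / 2 * nearestDist y j → ∃ n : E3, ‖n‖ = 1 ∧ ∀ m : Fin N, Pc m = hcpTwoShellPattern →
        dist (y m) (y i) ≤ 10 * nearestDist y i → ∃ τ : ℝ, (τ = 1 ∨ τ = -1) ∧
          ‖(‖Ac m ((Real.sqrt 18)⁻¹ • intVec ![4, 4, 4])‖⁻¹) • Ac m ((Real.sqrt 18)⁻¹ • intVec ![4, 4, 4]) - τ • n‖ ≤ 1 / 100 := by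
  obtain ⟨Ac, Qc, Pc, fc, hP, hA, hf, hinj, hex, -, -⟩ := charts_of_affDeepReg_radius (by linarith) hj
  refine ⟨Pc, Qc, Ac, fc, hP, hA, hf, hinj, hex, fun i hi => ?_⟩
  obtain ⟨n, hn, h⟩ := hub_uniaxial hy hP hA hf hinj hex hρ hi
    (nA := fun k => (‖Ac k ((Real.sqrt 18)⁻¹ • intVec ![4, 4, 4])‖⁻¹) • Ac k ((Real.sqrt 18)⁻¹ • intVec ![4, 4, 4])) (fun _ => rfl)
  refine ⟨n, hn, fun m hPm hm => ?_⟩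
  obtain ⟨τ, hτ, hd⟩ := h m hPm hm
  exact ⟨τ, hτ, hd.trans (by norm_num)⟩

/-- The literal instance of record `ρ₁ = 30` (the leaf datum of the order: `AffDeepReg 30 (10⁻⁴) (10⁻³) (1/450)` at the pivot). [this file] -/
theorem uniaxial_core_thirty {y : Fin N → E3} (hy : Function.Injective y) {j : Fin N}
    (hj : AffDeepReg 30 (1 / 10 ^ 4) (1 / 1000) (1 / 450) y j) :
    ∃ (Pc : Fin N → Finset E3) (Qc : Fin N → E3 →ₗᵢ[ℝ] E3) (Ac : Fin N → E3 →ₗ[ℝ] E3) (fc : Fin N → E3 → E3),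
      (∀ i, dist (y i) (y j) ≤ 30 * nearestDist y j → Pc i = fccTwoShellPattern ∨ Pc i = hcpTwoShellPattern) ∧
      (∀ i, dist (y i) (y j) ≤ 30 * nearestDist y j → ∀ v ∈ Pc i, ‖Ac i v - Qc i v‖ ≤ 1 / 1000) ∧
      (∀ i, dist (y i) (y j) ≤ 30 * nearestDist y j → ∀ v ∈ Pc i,
        fc i v ∈ Set.range y ∧ dist (fc i v) (y i + nearestDist y i • Ac i v) ≤ 1 / 10 ^ 4 * nearestDist y i) ∧
      (∀ i, dist (y i) (y j) ≤ 30 * nearestDist y j → Set.InjOn (fc i) ↑(Pc i)) ∧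
      (∀ i, dist (y i) (y j) ≤ 30 * nearestDist y j → ∀ k : Fin N, k ≠ i →
        dist (y k) (y i) ≤ (3 / 2 + 1 / 450) * nearestDist y i → ∃ v ∈ Pc i, fc i v = y k) ∧
      ∀ i, dist (y i) (y j) ≤ 5 / 2 * nearestDist y j → ∃ n : E3, ‖n‖ = 1 ∧ ∀ m : Fin N, Pc m = hcpTwoShellPattern →
        dist (y m) (y i) ≤ 10 * nearestDist y i → ∃ τ : ℝ, (τ = 1 ∨ τ = -1) ∧
          ‖(‖Ac m ((Real.sqrt 18)⁻¹ • intVec ![4, 4, 4])‖⁻¹) • Ac m ((Real.sqrt 18)⁻¹ • intVec ![4, 4, 4]) - τ • n‖ ≤ 1 / 100 :=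
  uniaxial_core_of_affDeepReg hy le_rfl hj

/-! ## §2 Metrology of the pivot ball -/

/-- `0.936 ≤ (10⁴/10011)^60` and `(10011/10⁴)^60 ≤ 1.069` (`1.0011^60 = 1.06819`): the numeric size of a window of exponent `≤ 60`. [this file] -/
theorem pow_sixty : (936 / 1000 : ℝ) ≤ (10000 / 10011 : ℝ) ^ 60 ∧ (10011 / 10000 : ℝ) ^ 60 ≤ 1069 / 1000 := by
  constructor <;> norm_num

/-- A window of exponent `s ≤ 60` about `x ≥ 0` lies inside `[0.936 x, 1.069 x]`. [this file] -/
theorem window_sixty {x z : ℝ} {s : ℕ} (hs : s ≤ 60) (hx : 0 ≤ x) (h1 : (10000 / 10011 : ℝ) ^ s * x ≤ z)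
    (h2 : z ≤ (10011 / 10000 : ℝ) ^ s * x) : 936 / 1000 * x ≤ z ∧ z ≤ 1069 / 1000 * x := by
  have hl := mul_le_mul_of_nonneg_right (pow_sixty.1.trans (pow_le_pow_of_le_one (by norm_num) (by norm_num) hs)) hx
  have hr := mul_le_mul_of_nonneg_right ((pow_le_pow_right₀ (by norm_num) hs).trans pow_sixty.2) hx
  constructor <;> linarith

/-- `0.989 ≤ (10⁴/10011)^10` and `(10011/10⁴)^10 ≤ 1.0111` (`1.0011^10 = 1.01106`): the numeric size of a mover's window (two hops). [this file] -/
theorem pow_ten : (989 / 1000 : ℝ) ≤ (10000 / 10011 : ℝ) ^ 10 ∧ (10011 / 10000 : ℝ) ^ 10 ≤ 10111 / 10000 := by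
  constructor <;> norm_num

section Atlas
/-! ONE chart datum on the ball `B(y j, ρ₁ ν_j)` (verbatim §2 of part 22A). -/
variable {y : Fin N → E3} (hy : Function.Injective y) {j : Fin N} {ρ₁ : ℝ}
  {Ac : Fin N → (E3 →ₗ[ℝ] E3)} {Qc : Fin N → (E3 →ₗᵢ[ℝ] E3)} {Pc : Fin N → Finset E3} {fc : Fin N → E3 → E3}
  (hP : ∀ i, dist (y i) (y j) ≤ ρ₁ * nearestDist y j → Pc i = fccTwoShellPattern ∨ Pc i = hcpTwoShellPattern)
  (hA : ∀ i, dist (y i) (y j) ≤ ρ₁ * nearestDist y j → ∀ v ∈ Pc i, ‖Ac i v - Qc i v‖ ≤ 1 / 1000)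
  (hf : ∀ i, dist (y i) (y j) ≤ ρ₁ * nearestDist y j → ∀ v ∈ Pc i,
    fc i v ∈ Set.range y ∧ dist (fc i v) (y i + nearestDist y i • Ac i v) ≤ 1 / 10 ^ 4 * nearestDist y i)
  (hinj : ∀ i, dist (y i) (y j) ≤ ρ₁ * nearestDist y j → Set.InjOn (fc i) ↑(Pc i))
  (hex : ∀ i, dist (y i) (y j) ≤ ρ₁ * nearestDist y j → ∀ k : Fin N, k ≠ i →
    dist (y k) (y i) ≤ (3 / 2 + 1 / 450) * nearestDist y i → ∃ v ∈ Pc i, fc i v = y k)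

include hy hP hA hf hinj hex

/-- ★ **THE SPACE WALK TO A POINT ARRIVES.**  From a charted site `p` toward a POINT `x` with `dist(y p, x) ≤ 3.17 ν_p`, the ball `B(x, dist(y p, x))`
charted: a chain `p = c 0 → … → c n` of first-shell registrations, `n ≤ 5`, staying in that ball, whose end has ARRIVED: `dist(y c_n, x) < ν_{c n}`.
While not arrived (`ν ≤ d`) the absolute law of `…RunCutLegCover.space_step` keeps the distance to `x` non-increasing and the normalised law holds;
`…RunCutLegCover.leg_envelope` (rung `3.17`, `3` bonds to `R ≤ 3/2`), 23C-α `law_below`, `law_arrive`: `R < 1` by bond `5`; `n` := the first arrival. [this file] -/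
theorem point_walk {p : Fin N} {x : E3} (hcont : ∀ z : Fin N, dist (y z) x ≤ dist (y p) x → dist (y z) (y j) ≤ ρ₁ * nearestDist y j)
    (hR0 : dist (y p) x ≤ 317 / 100 * nearestDist y p) :
    ∃ n, n ≤ 5 ∧ ∃ c : ℕ → Fin N, ∃ u : ℕ → E3, c 0 = p ∧ dist (y (c n)) x < nearestDist y (c n) ∧
      (∀ t < n, u t ∈ Pc (c t) ∧ ‖u t‖ = 1 ∧ fc (c t) (u t) = y (c (t + 1))) ∧
      (∀ t ≤ n, dist (y (c t)) x ≤ dist (y p) x) := by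
  -- one greedy step toward `x` from every charted site
  have key : ∀ z : Fin N, ∃ z' : Fin N, ∃ u : E3, dist (y z) (y j) ≤ ρ₁ * nearestDist y j →
      u ∈ Pc z ∧ ‖u‖ = 1 ∧ fc z u = y z' ∧
        dist (y z') x ^ 2 ≤ dist (y z) x ^ 2 - 1412 / 1000 * nearestDist y z * dist (y z) x + 10023 / 10000 * nearestDist y z ^ 2 := by
    intro z
    by_cases hz : dist (y z) (y j) ≤ ρ₁ * nearestDist y j
    · obtain ⟨u, hu, hu1, H⟩ := space_step hy (hP z hz) (hA z hz) (hf z hz) (hinj z hz) (x - y z)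
      obtain ⟨z', hz'⟩ := (hf z hz u hu).1
      obtain ⟨-, -, hlaw⟩ := H z' hz'.symm
      refine ⟨z', u, fun _ => ⟨hu, hu1, hz'.symm, ?_⟩⟩
      have e1 : x - y z - (y z' - y z) = x - y z' := by abel
      rw [e1, ← dist_eq_norm, ← dist_eq_norm, dist_comm x (y z'), dist_comm x (y z)] at hlaw
      exact hlaw
    · exact ⟨z, 0, fun h => absurd h hz⟩
  choose F U hFU using key
  obtain ⟨c, hc0, hcS⟩ : ∃ c : ℕ → Fin N, c 0 = p ∧ ∀ t, c (t + 1) = F (c t) :=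
    ⟨fun t => Nat.rec (motive := fun _ => Fin N) p (fun _ z => F z) t, rfl, fun _ => rfl⟩
  -- the invariant while the walk has not arrived
  have inv : ∀ t : ℕ, (∀ s < t, nearestDist y (c s) ≤ dist (y (c s)) x) →
      (∀ s ≤ t, dist (y (c s)) x ≤ dist (y p) x) ∧
      (∀ s < t, U (c s) ∈ Pc (c s) ∧ ‖U (c s)‖ = 1 ∧ fc (c s) (U (c s)) = y (c (s + 1))) ∧
      (∀ s < t, (dist (y (c (s + 1))) x / nearestDist y (c (s + 1))) ^ 2 ≤
        10067 / 10000 * ((dist (y (c s)) x / nearestDist y (c s)) ^ 2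
          - 1412 / 1000 * (dist (y (c s)) x / nearestDist y (c s)) + 10023 / 10000)) := by
    intro t
    induction t with
    | zero =>
      intro _
      refine ⟨fun s hs => ?_, fun s hs => absurd hs (Nat.not_lt_zero _), fun s hs => absurd hs (Nat.not_lt_zero _)⟩
      obtain rfl : s = 0 := Nat.le_zero.1 hs
      rw [hc0]
    | succ t ih =>
      intro hne
      obtain ⟨hd, hch, hlw⟩ := ih (fun s hs => hne s (Nat.lt_succ_of_lt hs))
      have hνd : nearestDist y (c t) ≤ dist (y (c t)) x := hne t (Nat.lt_succ_self t)
      have hbt : dist (y (c t)) (y j) ≤ ρ₁ * nearestDist y j := hcont _ (hd t le_rfl)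
      obtain ⟨hu, hu1, hfu, hl⟩ := hFU (c t) hbt
      rw [← hcS] at hfu hl
      have hνpos : 0 < nearestDist y (c t) := nearestDist_pos_of_frame hy (hP _ hbt) (fun v hv => (hf _ hbt v hv).1) (hinj _ hbt)
      have hdec : dist (y (c (t + 1))) x ≤ dist (y (c t)) x := by
        have h2 : dist (y (c (t + 1))) x ^ 2 ≤ dist (y (c t)) x ^ 2 := by
          nlinarith [hl, mul_nonneg hνpos.le (sub_nonneg.2 hνd), hνpos.le]
        exact (pow_le_pow_iff_left₀ dist_nonneg dist_nonneg two_ne_zero).1 h2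
      have hd1 : dist (y (c (t + 1))) x ≤ dist (y p) x := hdec.trans (hd t le_rfl)
      have hbt1 : dist (y (c (t + 1))) (y j) ≤ ρ₁ * nearestDist y j := hcont _ hd1
      obtain ⟨-, ⟨hlo, -⟩, -⟩ := bond_windows hy hP hA hf hinj hex hbt hbt1 hu hu1 hfu
      have hlawn := leg_law_normalise hνpos hlo hl
      refine ⟨fun s hs => ?_, fun s hs => ?_, fun s hs => ?_⟩
      · rcases Nat.lt_or_eq_of_le hs with hs' | rfl
        · exact hd s (Nat.lt_succ_iff.1 hs')
        · exact hd1
      · rcases Nat.lt_or_eq_of_le (Nat.lt_succ_iff.1 hs) with hs' | rfl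
        · exact hch s hs'
        · exact ⟨hu, hu1, hfu⟩
      · rcases Nat.lt_or_eq_of_le (Nat.lt_succ_iff.1 hs) with hs' | rfl
        · exact hlw s hs'
        · exact hlawn
  -- arrival by bond 5
  have harr : ∃ n, n ≤ 5 ∧ dist (y (c n)) x < nearestDist y (c n) := by
    by_contra hno'
    have hno : ∀ s ≤ 5, nearestDist y (c s) ≤ dist (y (c s)) x := fun s hs => not_lt.1 fun h => hno' ⟨s, hs, h⟩
    obtain ⟨hd, -, hlw⟩ := inv 5 (fun s hs => hno s hs.le)
    have hR1 : ∀ s ≤ 5, 1 ≤ dist (y (c s)) x / nearestDist y (c s) := by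
      intro s hs
      have hbs : dist (y (c s)) (y j) ≤ ρ₁ * nearestDist y j := hcont _ (hd s hs)
      have hνpos : 0 < nearestDist y (c s) := nearestDist_pos_of_frame hy (hP _ hbs) (fun v hv => (hf _ hbs v hv).1) (hinj _ hbs)
      exact (one_le_div hνpos).2 (hno s hs)
    have hR0' : ∀ s, 0 ≤ dist (y (c s)) x / nearestDist y (c s) := fun s => div_nonneg dist_nonneg (nearestDist_nonneg _ _)
    have hp0 : dist (y p) (y j) ≤ ρ₁ * nearestDist y j := hcont p le_rfl
    have hνp : 0 < nearestDist y p := nearestDist_pos_of_frame hy (hP _ hp0) (fun v hv => (hf _ hp0 v hv).1) (hinj _ hp0)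
    have hstart : dist (y (c 0)) x / nearestDist y (c 0) ≤ 317 / 100 := by rw [hc0, div_le_iff₀ hνp]; exact hR0
    obtain ⟨s, hs3, hs32⟩ := (leg_envelope (fun s => dist (y (c s)) x / nearestDist y (c s)) 0 3 hR0'
      (fun s hs _ => by rw [zero_add]; exact hlw s (by omega))).2.2 le_rfl hstart
    rw [zero_add] at hs32
    have h1 := law_below (hR1 s (by omega)) hs32 (hR0' (s + 1)) (hlw s (by omega))
    have h2 := law_arrive (hR1 (s + 1) (by omega)) h1 (hR0' (s + 1 + 1)) (hlw (s + 1) (by omega))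
    exact absurd (hR1 (s + 1 + 1) (by omega)) (not_le.2 h2)
  obtain ⟨n, hn5, hcn⟩ := harr
  have hexq : ∃ n, dist (y (c n)) x < nearestDist y (c n) := ⟨n, hcn⟩
  obtain ⟨hd, hch, -⟩ := inv (Nat.find hexq) (fun s hs => not_lt.1 (Nat.find_min hexq hs))
  exact ⟨Nat.find hexq, (Nat.find_min' hexq hcn).trans hn5, c, fun t => U (c t), hc0, Nat.find_spec hexq, hch, hd⟩

/-- ★ **PIVOT HOPS.**  `‖w‖ ≤ 2 ν_j`, `K ≤ 12`, `2K + 6 ≤ ρ₁`: for every `k ≤ K` some site `p` of the ball has ARRIVED at the point `y j + k•w`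
(`dist(y p, y j + k•w) < ν_p`) with window `(10⁴/10011)^e ν_j ≤ ν_p ≤ (10011/10⁴)^e ν_j`, `e ≤ 5k`.  Induction on `k`: hop `k+1` is the `point_walk` from the
previous arrival (`R₀ < (1 + 2/0.936) ≤ 3.17`; its ball `B(x′, (1.069 + 2) ν_j)` lies within `(2k + 5.07) ν_j ≤ ρ₁ ν_j` of `y j`); windows compose (23B-β
`leg_scale`, 23C-α `window_compose`). [this file] -/
theorem pivot_hops {w : E3} (hw : ‖w‖ ≤ 2 * nearestDist y j) {K : ℕ} (hK : K ≤ 12) (hρ : 2 * (K : ℝ) + 6 ≤ ρ₁) :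
    ∀ k ≤ K, ∃ p : Fin N, dist (y p) (y j) ≤ ρ₁ * nearestDist y j ∧ dist (y p) (y j + (k : ℝ) • w) < nearestDist y p ∧
      ∃ e : ℕ, e ≤ 5 * k ∧ (10000 / 10011 : ℝ) ^ e * nearestDist y j ≤ nearestDist y p ∧
        nearestDist y p ≤ (10011 / 10000 : ℝ) ^ e * nearestDist y j := by
  have hν0 : 0 ≤ nearestDist y j := nearestDist_nonneg _ _
  have hK0 : (0 : ℝ) ≤ K := Nat.cast_nonneg K
  have hj0 : dist (y j) (y j) ≤ ρ₁ * nearestDist y j := by rw [dist_self]; nlinarith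
  have hνj : 0 < nearestDist y j := nearestDist_pos_of_frame hy (hP _ hj0) (fun v hv => (hf _ hj0 v hv).1) (hinj _ hj0)
  intro k
  induction k with
  | zero =>
    intro _
    exact ⟨j, hj0, by simpa using hνj, 0, Nat.zero_le _, by simp, by simp⟩
  | succ k ih =>
    intro hk
    obtain ⟨p, hpball, hpx, e, he, hw1, hw2⟩ := ih (Nat.le_of_succ_le hk)
    obtain ⟨hlo, hhi⟩ := window_sixty (by omega) hν0 hw1 hw2
    have hk' : (k : ℝ) + 1 ≤ K := by exact_mod_cast hk
    -- the next target `x′ = (y j + k•w) + w`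
    have ex : y j + ((k + 1 : ℕ) : ℝ) • w = (y j + (k : ℝ) • w) + w := by rw [Nat.cast_succ, add_smul, one_smul, add_assoc]
    have hd0 : dist (y p) (y j + ((k + 1 : ℕ) : ℝ) • w) ≤ nearestDist y p + 2 * nearestDist y j := by
      rw [ex]
      have h1 := dist_triangle (y p) (y j + (k : ℝ) • w) (y j + (k : ℝ) • w + w)
      have h2 : dist (y j + (k : ℝ) • w) (y j + (k : ℝ) • w + w) = ‖w‖ := by
        rw [dist_comm, dist_eq_norm, add_sub_cancel_left]
      linarith [hpx.le]
    have hxj : dist (y j + ((k + 1 : ℕ) : ℝ) • w) (y j) ≤ 2 * ((k : ℝ) + 1) * nearestDist y j := by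
      rw [dist_eq_norm, add_sub_cancel_left, norm_smul, Nat.cast_succ, Real.norm_of_nonneg (by positivity)]
      have := mul_le_mul_of_nonneg_left hw (show (0 : ℝ) ≤ (k : ℝ) + 1 by positivity)
      linarith
    have hR0 : dist (y p) (y j + ((k + 1 : ℕ) : ℝ) • w) ≤ 317 / 100 * nearestDist y p := by linarith
    have hρ' := mul_le_mul_of_nonneg_right hρ hν0
    have hk'' := mul_le_mul_of_nonneg_right hk' hν0
    have hcont : ∀ z : Fin N, dist (y z) (y j + ((k + 1 : ℕ) : ℝ) • w) ≤ dist (y p) (y j + ((k + 1 : ℕ) : ℝ) • w) →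
        dist (y z) (y j) ≤ ρ₁ * nearestDist y j := by
      intro z hz
      have h1 := dist_triangle (y z) (y j + ((k + 1 : ℕ) : ℝ) • w) (y j)
      linarith
    obtain ⟨n, hn, c, u, hc0, harr, hch, hd⟩ := point_walk hy hP hA hf hinj hex hcont hR0
    have hball : ∀ t ≤ n, dist (y (c t)) (y j) ≤ ρ₁ * nearestDist y j := fun t ht => hcont _ (hd t ht)
    obtain ⟨hs1, hs2, -⟩ := leg_scale hy hP hA hf hinj hex c u n hball hch n le_rfl
    rw [hc0] at hs1 hs2
    obtain ⟨hl, hr⟩ := window_compose hw1 hw2 hs1 hs2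
    exact ⟨c n, hball n le_rfl, harr, e + n, by omega, hl, hr⟩

/-- ★★ **THE WINDOW OF EVERY SITE OF THE PIVOT BALL.**  `0 < K ≤ 12`, `2K + 6 ≤ ρ₁`: every site `m` with `dist(y m, y j) ≤ 2K ν_j` is charted with
`(10⁴/10011)^e ν_j ≤ ν_m ≤ (10011/10⁴)^e ν_j`, `e ≤ 5K` — `pivot_hops` along `w := K⁻¹ (y m − y j)`; the last hop targets `y m` itself, and arrival
`dist(y p, y m) < ν_p` forces `p = m` (`nearestDist_le_dist`). [this file] -/
theorem pivot_window {K : ℕ} (hK0 : 0 < K) (hK : K ≤ 12) (hρ : 2 * (K : ℝ) + 6 ≤ ρ₁) {m : Fin N}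
    (hm : dist (y m) (y j) ≤ 2 * K * nearestDist y j) :
    dist (y m) (y j) ≤ ρ₁ * nearestDist y j ∧ ∃ e : ℕ, e ≤ 5 * K ∧
      (10000 / 10011 : ℝ) ^ e * nearestDist y j ≤ nearestDist y m ∧ nearestDist y m ≤ (10011 / 10000 : ℝ) ^ e * nearestDist y j := by
  have hK0' : (0 : ℝ) < K := by exact_mod_cast hK0
  have hwn : ‖(K : ℝ)⁻¹ • (y m - y j)‖ ≤ 2 * nearestDist y j := by
    rw [norm_smul, norm_inv, Real.norm_of_nonneg hK0'.le, ← dist_eq_norm, inv_mul_le_iff₀ hK0']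
    linarith
  obtain ⟨p, hpball, hpx, e, he, h1, h2⟩ := pivot_hops hy hP hA hf hinj hex hwn hK hρ K le_rfl
  have ex : y j + (K : ℝ) • (K : ℝ)⁻¹ • (y m - y j) = y m := by
    rw [smul_smul, mul_inv_cancel₀ hK0'.ne', one_smul]; abel
  rw [ex] at hpx
  have hpm : p = m := by
    by_contra h
    exact (lt_irrefl _) ((nearestDist_le_dist y (fun e' => h e'.symm)).trans_lt hpx)
  subst hpm
  exact ⟨hpball, e, he, h1, h2⟩

/-- ★★ THE RECORD INSTANCE: `ρ₁ ≥ 30` (`K = 12`): every site within `24 ν_j` of the pivot is charted with `0.936 ν_j ≤ ν_m ≤ 1.069 ν_j`.  (Every mover's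
tight ball `B(y i, R_t ν_i)`, `R_t ≤ 20`, lies inside: `5/2 + 1.069·20 = 23.88 ≤ 24`.) [this file] -/
theorem pivot_window_thirty (hρ : 30 ≤ ρ₁) {m : Fin N} (hm : dist (y m) (y j) ≤ 24 * nearestDist y j) :
    dist (y m) (y j) ≤ ρ₁ * nearestDist y j ∧ 936 / 1000 * nearestDist y j ≤ nearestDist y m ∧ nearestDist y m ≤ 1069 / 1000 * nearestDist y j := by
  obtain ⟨hball, e, he, h1, h2⟩ := pivot_window hy hP hA hf hinj hex (K := 12) (by norm_num) le_rfl (by push_cast; linarith)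
    (m := m) (by push_cast; linarith)
  exact ⟨hball, window_sixty (by omega) (nearestDist_nonneg _ _) h1 h2⟩

/-- ★ THE MOVER'S OWN WINDOW (`ρ₁ ≥ 10`, two hops `K = 2`): a mover `i` (`dist(y i, y j) ≤ 5/2 ν_j`) is charted with `0.989 ν_j ≤ ν_i ≤ 1.0111 ν_j`
(sharper than the `1.019` of 23C-α `hub_leg`'s 17-bond walk). [this file] -/
theorem mover_window (hρ : 10 ≤ ρ₁) {i : Fin N} (hi : dist (y i) (y j) ≤ 5 / 2 * nearestDist y j) :
    dist (y i) (y j) ≤ ρ₁ * nearestDist y j ∧ 989 / 1000 * nearestDist y j ≤ nearestDist y i ∧ nearestDist y i ≤ 10111 / 10000 * nearestDist y j := by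
  have hν0 : 0 ≤ nearestDist y j := nearestDist_nonneg _ _
  obtain ⟨hball, e, he, h1, h2⟩ := pivot_window hy hP hA hf hinj hex (K := 2) (by norm_num) (by norm_num) (by push_cast; linarith)
    (m := i) (by push_cast; linarith)
  have he' : e ≤ 10 := by omega
  have hl := mul_le_mul_of_nonneg_right (pow_ten.1.trans (pow_le_pow_of_le_one (by norm_num) (by norm_num) he')) hν0
  have hr := mul_le_mul_of_nonneg_right ((pow_le_pow_right₀ (by norm_num) he').trans pow_ten.2) hν0
  exact ⟨hball, by linarith, by linarith⟩

/-- ★ A MOVER'S TIGHT BALL LIES IN THE PIVOT BALL: `ρ₁ ≥ 10`, mover `i`, any point `z` with `dist(z, y i) ≤ R ν_i` (`R ≥ 0`) has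
`dist(z, y j) ≤ (5/2 + 1.0111 R) ν_j`; at `R = 20`: `22.722 ν_j` — inside the `24 ν_j` of `pivot_window_thirty`, and `22.722 + 6.71·1.069 = 29.90 ≤ 30` is within
the reach of `no_crossing_local` (§3). [this file] -/
theorem tight_ball (hρ : 10 ≤ ρ₁) {i : Fin N} (hi : dist (y i) (y j) ≤ 5 / 2 * nearestDist y j) {z : E3} {R : ℝ} (hR : 0 ≤ R)
    (hz : dist z (y i) ≤ R * nearestDist y i) : dist z (y j) ≤ (5 / 2 + 10111 / 10000 * R) * nearestDist y j := by
  obtain ⟨-, -, hνi⟩ := mover_window hy hP hA hf hinj hex hρ hi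
  have h1 := dist_triangle z (y i) (y j)
  have h2 := mul_le_mul_of_nonneg_left hνi hR
  linarith

/-! ## §3 The event-local engine -/

/-- ★★ **NO CROSSING EVENT** (part 22D-β `cross_engine` at `K := 1`, `D := Z`; steps 0 and 2 of `cross_ends` with the common point GIVEN).  Two h-sites `ma`, `mb`
of the ball, windowed `lo ν_j ≤ ν ≤ hi ν_j` with `hi ≤ 27/20 lo`, whose frame axes read `|⟪na, nb⟫| ≤ c ≤ 87/250`, and a point `z` on both chart planes
(`⟪na, z − y ma⟫ = 0 = ⟪nb, z − y mb⟫`) within the walkers' range (`‖z − y ma‖ ≤ 957/25 ν_ma`, `‖z − y mb‖ ≤ 957/25 ν_mb`) such that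
`y ma`, `y mb`, `z` lie in `B(y j, Z ν_j)` with `Z + 671/100 hi ≤ ρ₁`: contradiction.  Two `walker_end`s (`R := Z ν_j`, `631/100 ν_m ≤ 671/100 hi ν_j`)
and the engine. [this file] -/
theorem no_crossing_local {ma mb : Fin N} (hballa : dist (y ma) (y j) ≤ ρ₁ * nearestDist y j) (hPa : Pc ma = hcpTwoShellPattern)
    (hballb : dist (y mb) (y j) ≤ ρ₁ * nearestDist y j) (hPb : Pc mb = hcpTwoShellPattern) (hνj : 0 < nearestDist y j)
    {na nb : E3} (hna : na = (‖Ac ma ((Real.sqrt 18)⁻¹ • intVec ![4, 4, 4])‖⁻¹ • Ac ma ((Real.sqrt 18)⁻¹ • intVec ![4, 4, 4]) : E3))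
    (hnb : nb = (‖Ac mb ((Real.sqrt 18)⁻¹ • intVec ![4, 4, 4])‖⁻¹ • Ac mb ((Real.sqrt 18)⁻¹ • intVec ![4, 4, 4]) : E3))
    {lo hi c Z : ℝ} (hc : |⟪na, nb⟫_ℝ| ≤ c) (hc' : c ≤ 87 / 250)
    (hloa : lo * nearestDist y j ≤ nearestDist y ma) (hhia : nearestDist y ma ≤ hi * nearestDist y j)
    (hlob : lo * nearestDist y j ≤ nearestDist y mb) (hhib : nearestDist y mb ≤ hi * nearestDist y j) (hS2 : hi ≤ 27 / 20 * lo)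
    {z : E3} (hz1 : ⟪na, z - y ma⟫_ℝ = 0) (hz2 : ⟪nb, z - y mb⟫_ℝ = 0)
    (hΛa : ‖z - y ma‖ ≤ 957 / 25 * nearestDist y ma) (hΛb : ‖z - y mb‖ ≤ 957 / 25 * nearestDist y mb)
    (hZa : dist (y ma) (y j) ≤ Z * nearestDist y j) (hZb : dist (y mb) (y j) ≤ Z * nearestDist y j) (hZz : dist z (y j) ≤ Z * nearestDist y j)
    (hS : Z + 671 / 100 * hi ≤ ρ₁) : False := by
  obtain ⟨hna1, hνa⟩ := unit_axis hy hA hf hinj hex hballa hPa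
  obtain ⟨-, hνb⟩ := unit_axis hy hA hf hinj hex hballb hPb
  rw [← hna] at hna1
  have hS' := mul_le_mul_of_nonneg_right hS hνj.le
  -- step 2 of the engine with the event given: both walkers access `z`
  obtain ⟨a₀, hball₀, hP₀, hwa, ⟨σa, hσa, haxa⟩, hhta, -, hza₀⟩ :=
    walker_end hy hP hA hf hinj hex hballa hPa hna hz1 le_rfl hΛa hZa hZz (by linarith only [hS', hhia, hνa])
  obtain ⟨b₀, hball₁, hP₁, hwb, ⟨σb, hσb, haxb⟩, -, -, hzb₀⟩ :=
    walker_end hy hP hA hf hinj hex hballb hPb hnb hz2 le_rfl hΛb hZb hZz (by linarith only [hS', hhib, hνb])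
  have hhza : |⟪na, z - y a₀⟫_ℝ| ≤ 60003 / 100000 * nearestDist y ma := by
    have e : ⟪na, z - y a₀⟫_ℝ = ⟪na, z - y ma⟫_ℝ - ⟪na, y a₀ - y ma⟫_ℝ := by
      rw [← inner_sub_right]; congr 1; abel
    rw [e, hz1, zero_sub, abs_neg]; exact hhta
  have hzx : ‖z - y j‖ ≤ 1 * (Z * nearestDist y j) := by rw [one_mul, ← dist_eq_norm]; exact hZz
  -- steps 3–7: the engine at `K := 1`, `D := Z`
  exact cross_engine hy hP hA hf hinj hex hball₀ hP₀ hball₁ hP₁ hνj hna1 hc hc' hwa hwb hσa haxa hσb haxb hhza hza₀ hzb₀ hzx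
    hloa hhia hlob hhib hνa hνb (by rw [one_mul]; exact hS) hS2

end Atlas

end Summit.AtomisticToContinuum.Crystallization.Theorems.OverbindingBudgetAffineRunCutUniax
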